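import Summits.CriticalPhenomena.PercolationContinuityZ3.Theorems.PercNearOneGluingNoHeavyQuantFarLayerOneForest
import Summits.CriticalPhenomena.PercolationContinuityZ3.Theorems.PercNearOneGluingNoHeavyQuantFarRelayRowTwoBlocks
import HarnessLib

/-!
# QUANT lane R8, front "FAR beyond trees" — a TREE observer with relays on both sides: layer one by two blocks

builds on p205010 (kernel theorem, internal audit signed; external expert review pending)

Support file (`--supports stmt-CriticalPhenomena-4575`), seat `prim-quant-p1` (gen 18); memo
`run/shared/lean/prim/quant/prim-quant-p1-g18/FOR-PROVERS-FLATTENING-FC.md` §1 (wrapper R2).  One definition (`Below`); standard axioms; no sorries.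

For a pendant forest on a cycle (`Bundle.PForest`) and an observer `o` that is a TREE vertex, the vertices strictly BELOW `o` (`Bundle.Below`: the parent chain
stays in `T` and reaches `o`) are separated from the rest by `o`.  If `A` has a relay below `o` and a relay not below `o`, layer one of FAR holds at `o`
unconditionally, by `Quant.farRelayRow_layerOne_of_twoBlocks`:
* `Quant.Bundle.below_sep` — no positive pair joins a vertex below `o` to a vertex neither below `o` nor equal to `o`;
* `Quant.Bundle.not_below_self` — `o` is not below itself (the ranking `dep` decreases along parent chains);
* **`Quant.Bundle.layerOne_of_pforest_treeObs_twoSides`**.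
[cite: KozmaNitzan2024, Conjecture 3 (p. 15)]; [cite: Grimmett1999, §1.3 p. 10]; [this work].
-/

noncomputable section

namespace Summit.CriticalPhenomena.PercolationContinuityZ3.Theorems

namespace Quant

namespace Bundle

open Finset MeasureTheory Set
open Literature.Probability.LatticeModels
open Literature.Probability.Percolation
open scoped Classical

variable {n : ℕ}

/-- `v` lies strictly BELOW `o` in the forest `(T, par)`: for some `k`, `par^{k+1} v = o` and `v, par v, …, par^k v ∈ T`. [this work] -/
def Below (T : Finset (Fin n)) (par : Fin n → Fin n) (o v : Fin n) : Prop :=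
  ∃ k : ℕ, par^[k + 1] v = o ∧ ∀ j, j ≤ k → par^[j] v ∈ T

section TreeObs

variable {L : ℕ} {cyc : ℕ → Fin n} {idx : Fin n → ℕ} {T : Finset (Fin n)} {par : Fin n → Fin n} {dep : Fin n → ℕ}
  {w : Sym2 (Fin n) → unitInterval} (P : PForest L cyc idx T par dep w)

omit P in
/-- A vertex below `o` is in `T`. [this work] -/
theorem Below.mem {o v : Fin n} (h : Below T par o v) : v ∈ T := by
  obtain ⟨k, -, hk⟩ := h
  simpa using hk 0 (Nat.zero_le k)

omit P in
/-- A child (in `T`) of `o` is below `o`. [this work] -/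
theorem below_of_par_eq {o v : Fin n} (hv : v ∈ T) (hpv : par v = o) : Below T par o v :=
  ⟨0, by simpa using hpv, fun j hj => by
    have : j = 0 := Nat.le_zero.1 hj
    subst this; simpa using hv⟩

omit P in
/-- A child (in `T`) of a vertex below `o` is below `o`. [this work] -/
theorem below_of_par_below {o u v : Fin n} (hv : v ∈ T) (hpv : par v = u) (hu : Below T par o u) : Below T par o v := by
  obtain ⟨k, hk, hchain⟩ := hu
  refine ⟨k + 1, ?_, ?_⟩
  · rw [Function.iterate_succ_apply, hpv]; exact hk
  · intro j hj
    rcases Nat.eq_zero_or_pos j with rfl | hjpos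
    · simpa using hv
    · obtain ⟨j', rfl⟩ : ∃ j', j = j' + 1 := ⟨j - 1, by omega⟩
      rw [Function.iterate_succ_apply, hpv]
      exact hchain j' (by omega)

omit P in
/-- The parent of a vertex below `o` is below `o` or is `o`. [this work] -/
theorem below_par_or_eq {o v : Fin n} (h : Below T par o v) : Below T par o (par v) ∨ par v = o := by
  obtain ⟨k, hk, hchain⟩ := h
  rcases Nat.eq_zero_or_pos k with rfl | hkpos
  · right; simpa using hk
  · left
    obtain ⟨k', rfl⟩ : ∃ k', k = k' + 1 := ⟨k - 1, by omega⟩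
    refine ⟨k', ?_, ?_⟩
    · rw [← Function.iterate_succ_apply]; exact hk
    · intro j hj
      rw [← Function.iterate_succ_apply]
      exact hchain (j + 1) (by omega)

include P

/-- The ranking decreases along a parent chain inside `T`. [this work] -/
theorem dep_iterate_lt {v : Fin n} : ∀ k : ℕ, (∀ j, j ≤ k + 1 → par^[j] v ∈ T) → dep (par^[k + 1] v) < dep v := by
  intro k
  induction k with
  | zero =>
    intro h
    have hv : v ∈ T := by simpa using h 0 (by omega)
    have hp : par v ∈ T := by simpa using h 1 (by omega)
    simpa using P.dep_lt v hv hp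
  | succ k ih =>
    intro h
    have h1 := ih fun j hj => h j (by omega)
    have hk1 : par^[k + 1] v ∈ T := h (k + 1) (by omega)
    have hk2 : par^[k + 2] v ∈ T := h (k + 2) le_rfl
    have e : par^[k + 2] v = par (par^[k + 1] v) := Function.iterate_succ_apply' par (k + 1) v
    have hstep := P.dep_lt (par^[k + 1] v) hk1 (by rw [← e]; exact hk2)
    rw [← e] at hstep
    exact lt_trans hstep h1

/-- A tree vertex is not below itself. [this work] -/
theorem not_below_self {o : Fin n} (hoT : o ∈ T) : ¬ Below T par o o := by
  rintro ⟨k, hk, hchain⟩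
  have hall : ∀ j, j ≤ k + 1 → par^[j] o ∈ T := by
    intro j hj
    rcases Nat.lt_or_ge j (k + 1) with hlt | hge
    · exact hchain j (by omega)
    · have : j = k + 1 := by omega
      rw [this, hk]; exact hoT
  have := dep_iterate_lt P k hall
  rw [hk] at this
  exact lt_irrefl _ this

/-- **Separation below a tree observer**: no positive pair joins a vertex below `o` to a vertex that is neither below `o` nor `o`. [this work] -/
theorem below_sep {o : Fin n} : ∀ u v : Fin n, u ∈ {x | Below T par o x} → v ∉ {x | Below T par o x} → v ≠ o → w s(u, v) = 0 := by
  intro u v hu hv hvo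
  simp only [mem_setOf_eq] at hu hv
  by_contra hw
  have huT : u ∈ T := hu.mem
  have hvu : v ≠ u := fun h => hv (h ▸ hu)
  rcases P.pair_at huT hvu hw with h | ⟨hvT, h⟩
  · -- `v = par u`
    rcases below_par_or_eq hu with h' | h'
    · exact hv (h ▸ h')
    · exact hvo (h.trans h')
  · -- `v` is a child of `u`
    exact hv (below_of_par_below hvT h hu)

/-- **Layer one for a TREE observer with relays on both sides** (unconditional): if `o ∈ T`, some relay lies below `o` and some relay does not, then
`2 < Σ_{a∈A} P(o ↔ a)` and `P(o ↮ a) ≤ t` on `A` imply `P(N_o ≤ 1) ≤ t` (`Quant.farRelayRow_layerOne_of_twoBlocks`). [this work] -/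
theorem layerOne_of_pforest_treeObs_twoSides {o : Fin n} (hoT : o ∈ T) (A : Finset (Fin n))
    (hA₁ : ∃ a ∈ A, Below T par o a) (hA₂ : ∃ b ∈ A, ¬ Below T par o b) (t : ℝ)
    (hEN : (2 : ℝ) < ∑ a ∈ A, (prodBernoulli w).real (openConn o a))
    (hcut : ∀ a ∈ A, (prodBernoulli w).real (openConn o a : Set (BondConfig (Fin n)))ᶜ ≤ t) :
    (prodBernoulli w).real {ω : BondConfig (Fin n) | (A.filter fun a => ω ∈ openConn o a).card ≤ 1} ≤ t :=
  Quant.farRelayRow_layerOne_of_twoBlocks n w A o {x | Below T par o x} (not_below_self P hoT) (below_sep P) hA₁ hA₂ t hEN hcut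

end TreeObs

end Bundle

end Quant

end Summit.CriticalPhenomena.PercolationContinuityZ3.Theorems
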